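import Literature.NumberTheory.CubicFields.UniformityEstimateProofs
import Literature.NumberTheory.CubicFields.ThreeTorsionSumFirstOrder
import Literature.NumberTheory.NumberFields.StickelbergerDiscriminant
import Mathlib.Algebra.Order.Field.GeomSum
import HarnessLib

/-!
# BTT Prop. 4.5: the fields bound from the mean of `#Cl₃` and the class-field-theoretic count per discriminant

`Proofs` file (theorems only: no definitions, no named facts). Topic `Literature/NumberTheory/CubicFields`;
continues `UniformityEstimateProofs.lean`, whose `btt_uniformity_sqDvd_of_fieldsBound` reduces the named fact
`btt_uniformity_sqDvd` (Bhargava–Taniguchi–Thorne 2023, Prop. 4.5) to the FIELDS BOUND: for odd squarefree `q`,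
`#{cubic fields K : 0 < ±d_K < X, q² ∣ d_K} ≤ M · 3^{ω(q)} · X/q²` — the case "odd `q`" of
Belabas–Bhargava–Pomerance 2010, Lemma 3.3.

BBP, proof of Lemma 3.3 (p. 12 of the authors' final version): "This is due to `Σ_{0<±D<X} #Cl₃(D) = O(X)`,
which follows from Lemmas 2.2 and 3.1, and a classical inequality bounding the `3`-rank of the ring class
group modulo `q` of `ℚ(√D)` by `ω(q) + r₃(√D) + O(1)`, already used by Davenport and Heilbronn [17]."
Accordingly the fields bound is assembled here from exactly two inputs, each stated on the tree's objects
and kept as an explicit hypothesis (no named fact is introduced):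

* (A) **the mean of `#Cl₃`** — `Σ_{D ∈ negFundDiscrs Y} #Cl₃(D) ≤ C·Y` and the same over `posFundDiscrs Y`
  (`quadFieldThreeTorsion`, `ThreeTorsion.lean`); in print: Davenport's `O(X)` count of cubic orders (BBP
  Lemma 2.2) with Hasse's theorem (BBP Lemma 3.1); here `mean_threeTorsion_of_dictionary_of_orbitCount`
  derives (A) from the dictionary `#Cl₃(D) = 2·#{cubic fields of disc D} + 1` (the statement of the tree's
  named fact `threeTorsion_eq_two_mul_cubicFieldCountOfDisc_add_one`, taken verbatim as a hypothesis) and an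
  `O(X)` bound for the orbits of irreducible forms (Davenport 1951);
* (B) **the count per discriminant** — for `D₀` a fundamental discriminant or `1` and `f ≥ 1`,
  `#{cubic fields of discriminant D₀f²} ≤ M · 3^{ω(f)} · #Cl₃(D₀)` (class field theory: a cubic field of
  discriminant `D₀f²` gives an order-`3` character of the ring class group modulo `f` of `ℚ(√D₀)`, whose
  `3`-rank is `≤ r₃(D₀) + ω(f) + O(1)`; for `D₀ = 1`, the cyclic cubic fields of conductor `f`; the tree's
  `quadFieldThreeTorsion 1 = 1`).

Proved here:
* `range_orbitOfClassOfDisc_eq`, `ncard_irredMaximalOrbitsOfDisc` — for EVERY `D`, the `GL₂(ℤ)`-orbits of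
  irreducible maximal forms of discriminant `D` are counted by `cubicFieldCountOfDisc D` (Delone–Faddeev /
  Davenport–Heilbronn, fibrewise; the tree had the fundamental case `cubicFieldCountOfDisc_eq_card_irredOrbitsOfDisc`);
* `exists_fundamental_mul_sq` — a nonzero `D ≡ 0, 1 (mod 4)` is `D₀ f²`, `D₀` fundamental or `1`, `f ≥ 1`;
* `sum_three_pow_card_primeFactors_div_sq_le` — `Σ_{n ≤ N} 3^{ω(n)}/n² ≤ e¹⁹`;
* **`fieldsBound_of_mean_of_perDisc`** — (A) and (B) imply the fields bound, with
  `M' = M (2C+1) e¹⁹`: group the fields by `d = D₀f²` (`q` odd squarefree and `q² ∣ D₀f²` force `q ∣ f`),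
  bound each group by (B), the `D₀`-sums by (A) at height `X/f²`, and sum `Σ_{q ∣ f} 3^{ω(f)}/f² ≤ e¹⁹ 3^{ω(q)}/q²`;
* **`btt_uniformity_sqDvd_of_mean_of_perDisc`** — hence (A) and (B) imply `btt_uniformity_sqDvd`;
* `mean_threeTorsion_of_dictionary_of_orbitCount` — (A) from the dictionary and Davenport's bound.

## References

* M. Bhargava, T. Taniguchi, F. Thorne, *Improved error estimates for the Davenport–Heilbronn theorems*,
  Math. Ann. 389 (2024) = arXiv:2107.12819, §4.2 Prop. 4.5 [BhargavaTaniguchiThorne2023].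
* K. Belabas, M. Bhargava, C. Pomerance, *Error estimates for the Davenport–Heilbronn theorems*, Duke Math. J.
  153 (2010) 173–210, Lemmas 2.2, 3.1, 3.3, 3.4 [BelabasBhargavaPomerance2010].
* H. Davenport, H. Heilbronn, *On the density of discriminants of cubic fields. II*, Proc. Roy. Soc. London
  A 322 (1971) 405–420, §6 [DavenportHeilbronn1971].
-/

noncomputable section

namespace Literature.NumberTheory.CubicFields

open NumberField BinaryCubic RingOfForm Finset Literature.NumberTheory.QuadraticFields
  Literature.NumberTheory.NumberFields

/-! ### Orbits of irreducible maximal forms of discriminant `D` = cubic fields of discriminant `D` -/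

/-- **The image of {cubic fields of disc `D`}/≅ → orbits is the set of orbits of irreducible MAXIMAL forms of
discriminant `D`** (all `D`): the orbit of `K` is that of an `f` with `R(f) ≅ 𝓞 K` (irreducible, maximal,
`Disc f = Disc K`); conversely an irreducible maximal `f` has `R(f) ≅ 𝓞 K_f` (`isMaximal_and_isIrreducible_iff`).
[cite: BhargavaTaniguchiThorne2023, §2.2 (cubic fields ↔ orbits of irreducible forms maximal at all p)] -/
theorem range_orbitOfClassOfDisc_eq (D : ℤ) :
    Set.range (orbitOfClassOfDisc (D := D)) =
      {O | ∃ f : BinaryCubic ℤ, O = gl2zOrbit f ∧ f.IsIrreducible ∧ IsMaximal f ∧ f.disc = D} := by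
  refine Set.Subset.antisymm ?_ ?_
  · rintro O ⟨c, rfl⟩
    induction c using Quotient.inductionOn with | h K => ?_
    obtain ⟨eK⟩ := nonempty_ringEquiv_chosenFormOfDisc K
    refine ⟨_, rfl, isIrreducible_of_ringEquiv_ringOfIntegers eK, ?_, ?_⟩
    · exact (isMaximal_and_isIrreducible_iff.mpr ⟨_, inferInstance, inferInstance, K.2.1, ⟨eK⟩⟩).1
    · rw [disc_eq_discr_of_ringEquiv_ringOfIntegers K.2.1 eK]
      exact K.2.2
  · rintro O ⟨f, rfl, hirr, hmax, hdisc⟩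
    obtain ⟨K, _, _, h3, ⟨e⟩⟩ := isMaximal_and_isIrreducible_iff.mp ⟨hmax, hirr⟩
    have hdK : f.disc = discr K := disc_eq_discr_of_ringEquiv_ringOfIntegers h3 e
    obtain ⟨F, hF, ⟨φ⟩⟩ := exists_mem_cubicSubfieldsOfDisc_algEquiv K h3
    rw [← hdK, hdisc] at hF
    refine ⟨Quotient.mk _ ⟨F, hF⟩, ?_⟩
    change orbitOfFieldOfDisc ⟨F, hF⟩ = gl2zOrbit f
    obtain ⟨eF⟩ := nonempty_ringEquiv_chosenFormOfDisc (⟨F, hF⟩ : cubicSubfieldsOfDisc D)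
    exact gl2zOrbit_eq_iff.mpr (gl2zEquiv_of_ringEquiv_ringOfIntegers_of_ringEquiv eF e φ.symm.toRingEquiv)

/-- **`#{orbits of irreducible maximal forms of disc D} = #{cubic fields of disc D}/≅`** for every `D`. [cite: BhargavaTaniguchiThorne2023, §2.2 (cubic fields ↔ orbits of irreducible forms maximal at all p)] -/
theorem ncard_irredMaximalOrbitsOfDisc (D : ℤ) :
    {O | ∃ f : BinaryCubic ℤ, O = gl2zOrbit f ∧ f.IsIrreducible ∧ IsMaximal f ∧ f.disc = D}.ncard =
      cubicFieldCountOfDisc D := by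
  rw [cubicFieldCountOfDisc, ← Nat.card_range_of_injective (orbitOfClassOfDisc_injective (D := D)),
    range_orbitOfClassOfDisc_eq, Nat.card_coe_set_eq]

/-- The set of orbits of irreducible maximal forms of discriminant `D ≠ 0` is finite. [folklore] -/
theorem irredMaximalOrbitsOfDisc_finite {D : ℤ} (hD : D ≠ 0) :
    {O | ∃ f : BinaryCubic ℤ, O = gl2zOrbit f ∧ f.IsIrreducible ∧ IsMaximal f ∧ f.disc = D}.Finite :=
  (orbitsOfDisc_finite hD).subset fun _ ⟨f, hO, _, _, hd⟩ => ⟨f, hO, hd⟩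

/-- A discriminant carrying a cubic field is nonzero and `≡ 0, 1 (mod 4)` (Stickelberger). [folklore] -/
theorem ne_zero_and_emod_four_of_cubicFieldCountOfDisc_ne_zero {D : ℤ} (h : cubicFieldCountOfDisc D ≠ 0) :
    D ≠ 0 ∧ (D % 4 = 0 ∨ D % 4 = 1) := by
  have hne : Nonempty (CubicFieldClassesOfDisc D) := by
    by_contra hc
    rw [not_nonempty_iff] at hc
    exact h (by rw [cubicFieldCountOfDisc]; exact Nat.card_of_isEmpty)
  obtain ⟨c⟩ := hne
  induction c using Quotient.inductionOn with | h K => ?_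
  obtain ⟨-, hD⟩ := K.2
  exact ⟨hD ▸ NumberField.discr_ne_zero _, hD ▸ stickelberger_discr_emod_four _⟩

/-! ### `D = D₀ f²` with `D₀` fundamental or `1` -/

/-- **Every nonzero `D ≡ 0, 1 (mod 4)` is `D₀ f²` with `D₀` a fundamental discriminant or `1` and `f ≥ 1`**:
write `D = m b²` with `m` squarefree; if `m ≡ 1 (mod 4)` take `D₀ = m`, otherwise `m ≡ 2, 3 (mod 4)`, `b` is
even and `D₀ = 4m`, `f = b/2`. [folklore] -/
theorem exists_fundamental_mul_sq {D : ℤ} (hD : D ≠ 0) (h4 : D % 4 = 0 ∨ D % 4 = 1) :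
    ∃ D₀ : ℤ, ∃ f : ℕ, (((D₀ % 4 = 1 ∧ Squarefree D₀ ∧ D₀ ≠ 1) ∨
      (4 ∣ D₀ ∧ (D₀ / 4 % 4 = 2 ∨ D₀ / 4 % 4 = 3) ∧ Squarefree (D₀ / 4))) ∨ D₀ = 1) ∧
      0 < f ∧ D = D₀ * (f : ℤ) ^ 2 := by
  obtain ⟨a, b, ha, hb, hab, hsq⟩ := Nat.sq_mul_squarefree_of_pos (Int.natAbs_pos.mpr hD)
  -- `m = D / b²`, `D = m b²`, `|m| = a` squarefree
  have hbdvd : ((b : ℤ) ^ 2) ∣ D := by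
    rw [← Int.dvd_natAbs, ← hab]
    push_cast
    exact dvd_mul_right _ _
  obtain ⟨m, hm⟩ := hbdvd
  have hma : m.natAbs = a := by
    have h1 : D.natAbs = b ^ 2 * m.natAbs := by rw [hm, Int.natAbs_mul, Int.natAbs_pow]; simp
    have h2 : b ^ 2 * m.natAbs = b ^ 2 * a := by rw [← h1, hab]
    exact Nat.eq_of_mul_eq_mul_left (by positivity) h2
  have hmsq : Squarefree m := by rw [← Int.squarefree_natAbs, hma]; exact hsq
  have hm0 : m ≠ 0 := by rintro rfl; exact hD (by rw [hm, mul_zero])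
  -- `4 ∤ m`
  have hm4 : ¬ (4 : ℤ) ∣ m := fun h => by
    have h22 : (2 : ℤ) * 2 ∣ m := by norm_num; exact h
    have hu := hmsq 2 h22
    rw [Int.isUnit_iff] at hu
    omega
  by_cases hm1 : m % 4 = 1
  · refine ⟨m, b, ?_, hb, by rw [hm]; ring⟩
    by_cases hm_one : m = 1
    · exact Or.inr hm_one
    · exact Or.inl (Or.inl ⟨hm1, hmsq, hm_one⟩)
  · -- `m ≡ 2, 3 (mod 4)`; `b` is even
    have hm23 : m % 4 = 2 ∨ m % 4 = 3 := by
      have h0 : m % 4 ≠ 0 := fun h => hm4 (Int.dvd_of_emod_eq_zero h)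
      omega
    obtain ⟨k, hk⟩ : 2 ∣ b := by
      by_contra hodd
      obtain ⟨k, hk⟩ : Odd b := Nat.odd_iff.mpr (by omega)
      have hb2 : ((b : ℤ) ^ 2) = 4 * ((k : ℤ) ^ 2 + k) + 1 := by rw [hk]; push_cast; ring
      have hDm : D = 4 * (m * ((k : ℤ) ^ 2 + k)) + m := by rw [hm, hb2]; ring
      have : D % 4 = m % 4 := by rw [hDm]; omega
      omega
    refine ⟨4 * m, k, Or.inl (Or.inr ⟨dvd_mul_right 4 m, ?_, ?_⟩), by omega, ?_⟩
    · rw [Int.mul_ediv_cancel_left m (by norm_num)]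
      exact hm23
    · rw [Int.mul_ediv_cancel_left m (by norm_num)]
      exact hmsq
    · rw [hm, hk]
      push_cast
      ring

/-- For `q` odd squarefree, `D₀` fundamental or `1`, and `q² ∣ D₀ f²`: `q ∣ f` (an odd prime `p` with
`p² ∣ D₀f²`, `p ∤ f` would give `p² ∣ D₀`). [folklore] -/
theorem dvd_of_sq_dvd_fundamental_mul_sq {q : ℕ} (hq : Squarefree q) (hq2 : ¬ 2 ∣ q) {D₀ : ℤ}
    (hD₀ : ((D₀ % 4 = 1 ∧ Squarefree D₀ ∧ D₀ ≠ 1) ∨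
      (4 ∣ D₀ ∧ (D₀ / 4 % 4 = 2 ∨ D₀ / 4 % 4 = 3) ∧ Squarefree (D₀ / 4))) ∨ D₀ = 1) {f : ℕ}
    (hdvd : ((q : ℕ) : ℤ) ^ 2 ∣ D₀ * (f : ℤ) ^ 2) : q ∣ f := by
  -- every prime of `q` divides `f`
  have hp : ∀ p ∈ q.primeFactors, p ∣ f := by
    intro p hp
    have hpq := Nat.dvd_of_mem_primeFactors hp
    have hpp := Nat.prime_of_mem_primeFactors hp
    have hp2 : p ≠ 2 := fun h2 => hq2 (h2 ▸ hpq)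
    have hpZ : Prime (p : ℤ) := Nat.prime_iff_prime_int.mp hpp
    by_contra hpf
    have hpf' : ¬ (p : ℤ) ∣ (f : ℤ) ^ 2 := fun h =>
      hpf (Int.natCast_dvd_natCast.mp (Int.Prime.dvd_pow' hpp h))
    have hp2D : (p : ℤ) ^ 2 ∣ D₀ * (f : ℤ) ^ 2 :=
      (pow_dvd_pow_of_dvd (Int.natCast_dvd_natCast.mpr hpq) 2).trans hdvd
    have hsqD : (p : ℤ) ^ 2 ∣ D₀ := hpZ.pow_dvd_of_dvd_mul_right 2 hpf' hp2D
    have hnot_unit : ¬ IsUnit (p : ℤ) := hpZ.not_unit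
    rcases hD₀ with (⟨-, hsf, -⟩ | ⟨h4, -, hsf⟩) | rfl
    · exact hnot_unit (hsf p (by rw [← sq]; exact hsqD))
    · -- `p² ∣ 4 · (D₀/4)` with `p` odd
      obtain ⟨e, he⟩ := h4
      have he' : D₀ / 4 = e := by rw [he, Int.mul_ediv_cancel_left e (by norm_num)]
      rw [he'] at hsf
      rw [he] at hsqD
      have hp4 : ¬ (p : ℤ) ∣ 4 := fun h => by
        have h' : (p : ℤ) ∣ (2 : ℤ) ^ 2 := by norm_num; exact h
        have h2 := Int.Prime.dvd_pow' hpp h'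
        have : (p : ℤ) ≤ 2 := Int.le_of_dvd (by norm_num) h2
        have : 2 ≤ p := hpp.two_le
        omega
      have hsqe : (p : ℤ) ^ 2 ∣ e := hpZ.pow_dvd_of_dvd_mul_left 2 hp4 hsqD
      exact hnot_unit (hsf p (by rw [← sq]; exact hsqe))
    · exact hnot_unit (isUnit_of_dvd_one ((dvd_pow_self (p : ℤ) two_ne_zero).trans hsqD))
  rw [← Nat.prod_primeFactors_of_squarefree hq]
  exact Finset.prod_primes_dvd f (fun p hp => Nat.prime_iff.mp (Nat.prime_of_mem_primeFactors hp)) hp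

/-! ### `Σ_{n ≤ N} 3^{ω(n)}/n² ≤ e¹⁹` -/

/-- **`Σ_{n=1}^{N} 3^{ω(n)}/n² ≤ e¹⁹`**: `3^{ω}` is multiplicative with Euler factor
`1 + 3(p⁻² + p⁻⁴ + …) ≤ 1 + 4p⁻² ≤ 1 + 19p⁻²`, and `∏_p (1 + 19p⁻²) ≤ e¹⁹`
(`sum_Icc_le_of_prod_le`, `prod_le_exp_of_le` of `UniformitySubringEuler.lean`). [folklore] -/
theorem sum_three_pow_card_primeFactors_div_sq_le (N : ℕ) :
    ∑ n ∈ Icc 1 N, ((3 ^ n.primeFactors.card : ℕ) : ℝ) / (n : ℝ) ^ 2 ≤ Real.exp 19 := by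
  refine sum_Icc_le_of_prod_le (fun n => 3 ^ n.primeFactors.card) (fun _ i => if i = 0 then 1 else 3)
    (fun p => 1 + 19 * ((p : ℝ) ^ 2)⁻¹) ?_ ?_ (by simp) (fun p _ => by positivity)
    (fun P hP => prod_le_exp_of_le P hP _ (fun q _ => by positivity) fun q _ => le_rfl) N
  · -- multiplicativity: `ω(pⁱ m) = [i ≠ 0] + ω(m)` for `p ∤ m`
    intro p hp i m hpm hm0
    rcases Nat.eq_zero_or_pos i with rfl | hi
    · simp
    · have hdisj : Disjoint (p ^ i).primeFactors m.primeFactors := by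
        rw [Nat.primeFactors_prime_pow hi.ne' hp, Finset.disjoint_singleton_left]
        exact fun h => hpm (Nat.dvd_of_mem_primeFactors h)
      rw [Nat.primeFactors_mul (pow_ne_zero i hp.ne_zero) hm0, Finset.card_union_of_disjoint hdisj,
        Nat.primeFactors_prime_pow hi.ne' hp, Finset.card_singleton, pow_add, pow_one, if_neg hi.ne']
  · -- Euler factor: `1 + 3 Σ_{1 ≤ i < I} xⁱ ≤ 1 + 3x/(1-x) ≤ 1 + 4x`, `x = p⁻² ≤ 1/4`
    intro p hp I
    set x : ℝ := ((p : ℝ) ^ 2)⁻¹ with hx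
    obtain ⟨hx0, hx4, -, -⟩ := inv_sq_bounds p hp.two_le
    rw [← hx] at hx0 hx4
    have hx1 : x < 1 := by linarith
    have hsplit : ∑ i ∈ range I, ((if i = 0 then 1 else 3 : ℕ) : ℝ) * x ^ i ≤ 1 + 3 * ∑ i ∈ Ico 1 I, x ^ i := by
      rcases Nat.eq_zero_or_pos I with rfl | hI
      · simp
      · have hIco : range I = insert 0 (Ico 1 I) := by
          rw [Finset.range_eq_Ico]
          exact (Finset.insert_Ico_succ_left_eq_Ico hI).symm
        rw [hIco, Finset.sum_insert (by simp), Finset.mul_sum]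
        simp only [if_true, Nat.cast_one, pow_zero, mul_one]
        have hle : ∑ i ∈ Ico 1 I, ((if i = 0 then 1 else 3 : ℕ) : ℝ) * x ^ i ≤ ∑ i ∈ Ico 1 I, 3 * x ^ i := by
          refine Finset.sum_le_sum fun i hi => ?_
          have hi1 : i ≠ 0 := by have := (Finset.mem_Ico.mp hi).1; omega
          rw [if_neg hi1]
          push_cast
          exact le_rfl
        linarith
    have hgeom : ∑ i ∈ Ico 1 I, x ^ i ≤ x ^ 1 / (1 - x) := geom_sum_Ico_le_of_lt_one hx0 hx1
    have hfrac : x ^ 1 / (1 - x) ≤ 4 / 3 * x := by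
      rw [pow_one, div_le_iff₀ (by linarith)]
      nlinarith
    linarith

/-! ### Disjoint unions counted by `ncard` -/

/-- The `ncard` of a finite pairwise-disjoint union indexed by a finset is the sum of the `ncard`s. [folklore] -/
theorem ncard_biUnion_eq_sum_of_disjoint {ι α : Type*} [DecidableEq ι] (I : Finset ι) (S : ι → Set α)
    (hfin : ∀ i ∈ I, (S i).Finite) (hdisj : ∀ i ∈ I, ∀ j ∈ I, i ≠ j → Disjoint (S i) (S j)) :
    (⋃ i ∈ I, S i).ncard = ∑ i ∈ I, (S i).ncard := by
  induction I using Finset.induction_on with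
  | empty => simp
  | insert a I haI ih =>
    have hfin' : ∀ i ∈ I, (S i).Finite := fun i hi => hfin i (Finset.mem_insert_of_mem hi)
    have hdisj' : ∀ i ∈ I, ∀ j ∈ I, i ≠ j → Disjoint (S i) (S j) := fun i hi j hj =>
      hdisj i (Finset.mem_insert_of_mem hi) j (Finset.mem_insert_of_mem hj)
    rw [Finset.set_biUnion_insert, Finset.sum_insert haI, ← ih hfin' hdisj']
    refine Set.ncard_union_eq ?_ (hfin a (Finset.mem_insert_self a I)) (Set.Finite.biUnion I.finite_toSet hfin')
    rw [Set.disjoint_iUnion₂_right]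
    exact fun i hi => hdisj a (Finset.mem_insert_self a I) i (Finset.mem_insert_of_mem hi)
      (fun h => haI (h ▸ hi))

/-- The `ncard` of a finite union indexed by a finset is at most the sum of the `ncard`s. [folklore] -/
theorem ncard_biUnion_le_sum {ι α : Type*} [DecidableEq ι] (I : Finset ι) (S : ι → Set α) :
    (⋃ i ∈ I, S i).ncard ≤ ∑ i ∈ I, (S i).ncard := by
  induction I using Finset.induction_on with
  | empty => simp
  | insert a I haI ih =>
    rw [Finset.set_biUnion_insert, Finset.sum_insert haI]
    exact (Set.ncard_union_le _ _).trans (Nat.add_le_add_left ih _)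

/-! ### The fields bound from (A) and (B) -/

/-- **The fields bound from the mean of `#Cl₃` (A) and the count per discriminant (B)** (the case "odd `q`" of
Belabas–Bhargava–Pomerance 2010, Lemma 3.3, assembled as in its printed proof): if
(A) `Σ_{D ∈ negFundDiscrs Y} #Cl₃(D) ≤ C·Y` and `Σ_{D ∈ posFundDiscrs Y} #Cl₃(D) ≤ C·Y` for all `Y`, and
(B) `#{cubic fields of disc D₀f²} ≤ M·3^{ω(f)}·#Cl₃(D₀)` for `D₀` fundamental or `1` and `f ≥ 1`, then for all odd
squarefree `q`, `s = ±1`, `X`, the orbits of irreducible maximal forms (cubic fields) with `0 < s·Disc < X` and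
`q² ∣ Disc` number `≤ M(2C+1)e¹⁹ · 3^{ω(q)} X/q²`. Proof: group by `Disc = D₀f²` (`q ∣ f`, `f² ≤ X`), apply (B),
then (A) at height `⌊(X−1)/f²⌋ + 1 ≤ 2X/f²`, then `Σ_{q ∣ f} 3^{ω(f)}/f² ≤ e¹⁹ 3^{ω(q)}/q²`.
[cite: BelabasBhargavaPomerance2010, Lemma 3.3 (proof)] -/
theorem fieldsBound_of_mean_of_perDisc
    (hA : ∃ C : ℝ, ∀ Y : ℕ, (∑ D ∈ negFundDiscrs Y, (quadFieldThreeTorsion D : ℝ)) ≤ C * Y ∧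
      (∑ D ∈ posFundDiscrs Y, (quadFieldThreeTorsion D : ℝ)) ≤ C * Y)
    (hB : ∃ M : ℝ, ∀ D₀ : ℤ, (((D₀ % 4 = 1 ∧ Squarefree D₀ ∧ D₀ ≠ 1) ∨
      (4 ∣ D₀ ∧ (D₀ / 4 % 4 = 2 ∨ D₀ / 4 % 4 = 3) ∧ Squarefree (D₀ / 4))) ∨ D₀ = 1) → ∀ f : ℕ, 0 < f →
      (cubicFieldCountOfDisc (D₀ * (f : ℤ) ^ 2) : ℝ) ≤ M * 3 ^ f.primeFactors.card * quadFieldThreeTorsion D₀) :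
    ∃ M : ℝ, ∀ q : ℕ, Squarefree q → ¬ 2 ∣ q → ∀ s : ℤ, (s = 1 ∨ s = -1) → ∀ X : ℕ,
      (({O | ∃ f : BinaryCubic ℤ, O = gl2zOrbit f ∧ f.IsIrreducible ∧ IsMaximal f ∧ 0 < s * f.disc ∧
        s * f.disc < X ∧ ((q : ℕ) : ℤ) ^ 2 ∣ f.disc}.ncard : ℕ) : ℝ) ≤ M * 3 ^ q.primeFactors.card * X / (q : ℝ) ^ 2 := by
  classical
  obtain ⟨C₀, hC₀⟩ := hA
  obtain ⟨M₀, hM₀⟩ := hB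
  -- nonnegative constants
  set C : ℝ := max C₀ 0 with hCdef
  set M : ℝ := max M₀ 0 with hMdef
  have hC0 : 0 ≤ C := le_max_right _ _
  have hM0 : 0 ≤ M := le_max_right _ _
  have hAC : ∀ Y : ℕ, (∑ D ∈ negFundDiscrs Y, (quadFieldThreeTorsion D : ℝ)) ≤ C * Y ∧
      (∑ D ∈ posFundDiscrs Y, (quadFieldThreeTorsion D : ℝ)) ≤ C * Y := fun Y =>
    ⟨(hC₀ Y).1.trans (mul_le_mul_of_nonneg_right (le_max_left _ _) (Nat.cast_nonneg Y)),
      (hC₀ Y).2.trans (mul_le_mul_of_nonneg_right (le_max_left _ _) (Nat.cast_nonneg Y))⟩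
  have hBM : ∀ D₀ : ℤ, (((D₀ % 4 = 1 ∧ Squarefree D₀ ∧ D₀ ≠ 1) ∨
      (4 ∣ D₀ ∧ (D₀ / 4 % 4 = 2 ∨ D₀ / 4 % 4 = 3) ∧ Squarefree (D₀ / 4))) ∨ D₀ = 1) → ∀ f : ℕ, 0 < f →
      (cubicFieldCountOfDisc (D₀ * (f : ℤ) ^ 2) : ℝ) ≤ M * 3 ^ f.primeFactors.card * quadFieldThreeTorsion D₀ :=
    fun D₀ hD₀ f hf => (hM₀ D₀ hD₀ f hf).trans (mul_le_mul_of_nonneg_right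
      (mul_le_mul_of_nonneg_right (le_max_left _ _) (by positivity)) (Nat.cast_nonneg _))
  refine ⟨M * (2 * C + 1) * Real.exp 19, fun q hq hq2 s hs X => ?_⟩
  have hq0 : 0 < q := Nat.pos_of_ne_zero fun h => by rw [h] at hq; exact not_squarefree_zero hq
  have hs1 : s * s = 1 := by rcases hs with rfl | rfl <;> norm_num
  -- notation
  set S : Set (Set (BinaryCubic ℤ)) := {O | ∃ f : BinaryCubic ℤ, O = gl2zOrbit f ∧ f.IsIrreducible ∧
    IsMaximal f ∧ 0 < s * f.disc ∧ s * f.disc < X ∧ ((q : ℕ) : ℤ) ^ 2 ∣ f.disc} with hSdef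
  set Sd : ℤ → Set (Set (BinaryCubic ℤ)) := fun d =>
    {O | ∃ f : BinaryCubic ℤ, O = gl2zOrbit f ∧ f.IsIrreducible ∧ IsMaximal f ∧ f.disc = d} with hSd
  set W : Finset ℤ := (discWindow s X).filter (fun d => ((q : ℕ) : ℤ) ^ 2 ∣ d ∧ cubicFieldCountOfDisc d ≠ 0)
    with hWdef
  have hW0 : ∀ d ∈ W, d ≠ 0 := fun d hd =>
    (ne_zero_and_emod_four_of_cubicFieldCountOfDisc_ne_zero (Finset.mem_filter.mp hd).2.2).1
  -- Step 1: `#S ≤ Σ_{d ∈ W} N₃(d)`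
  have hstep1 : (S.ncard : ℝ) ≤ ∑ d ∈ W, (cubicFieldCountOfDisc d : ℝ) := by
    have hsub : S ⊆ ⋃ d ∈ W, Sd d := by
      rintro O ⟨f, rfl, hirr, hmax, h0, hX, hqd⟩
      have hmemSd : gl2zOrbit f ∈ Sd f.disc := ⟨f, rfl, hirr, hmax, rfl⟩
      have hN : cubicFieldCountOfDisc f.disc ≠ 0 := by
        rw [← ncard_irredMaximalOrbitsOfDisc]
        have hd0 : f.disc ≠ 0 := by rintro h; rw [h, mul_zero] at h0; exact lt_irrefl 0 h0
        exact (Set.ncard_pos (irredMaximalOrbitsOfDisc_finite hd0)).mpr ⟨_, hmemSd⟩ |>.ne'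
      refine Set.mem_biUnion (Finset.mem_coe.mpr (Finset.mem_filter.mpr ⟨(mem_discWindow hs).mpr ⟨h0, hX⟩, hqd, hN⟩))
        hmemSd
    have hfinU : (⋃ d ∈ W, Sd d).Finite :=
      Set.Finite.biUnion W.finite_toSet fun d hd => irredMaximalOrbitsOfDisc_finite (hW0 d hd)
    calc (S.ncard : ℝ) ≤ ((⋃ d ∈ W, Sd d).ncard : ℝ) := by exact_mod_cast Set.ncard_le_ncard hsub hfinU
      _ ≤ ((∑ d ∈ W, (Sd d).ncard : ℕ) : ℝ) := by exact_mod_cast ncard_biUnion_le_sum W Sd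
      _ = ∑ d ∈ W, (cubicFieldCountOfDisc d : ℝ) := by
          push_cast
          exact Finset.sum_congr rfl fun d _ => by rw [ncard_irredMaximalOrbitsOfDisc]
  -- Step 2: the decomposition `d = D₀(d) · f(d)²` on `W`
  have hdec : ∀ d ∈ W, ∃ D₀ : ℤ, ∃ f : ℕ, (((D₀ % 4 = 1 ∧ Squarefree D₀ ∧ D₀ ≠ 1) ∨
      (4 ∣ D₀ ∧ (D₀ / 4 % 4 = 2 ∨ D₀ / 4 % 4 = 3) ∧ Squarefree (D₀ / 4))) ∨ D₀ = 1) ∧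
      0 < f ∧ d = D₀ * (f : ℤ) ^ 2 := fun d hd => by
    obtain ⟨h0, h4⟩ := ne_zero_and_emod_four_of_cubicFieldCountOfDisc_ne_zero (Finset.mem_filter.mp hd).2.2
    exact exists_fundamental_mul_sq h0 h4
  choose! D₀f ff hD₀f hff hdeq using hdec
  -- the height `Y_f = ⌊(X-1)/f²⌋ + 1` and the `D₀`-range `E f`
  set Y : ℕ → ℕ := fun f => (X - 1) / f ^ 2 + 1 with hYdef
  set E : ℕ → Finset ℤ := fun f => insert 1 (if s = 1 then posFundDiscrs (Y f) else negFundDiscrs (Y f)) with hEdef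
  set F : Finset ℕ := (Icc 1 X).filter (fun f => q ∣ f ∧ f ^ 2 ≤ X) with hFdef
  set g : (Σ _ : ℕ, ℤ) → ℝ := fun x => M * 3 ^ x.1.primeFactors.card * quadFieldThreeTorsion x.2 with hgdef
  have hg0 : ∀ x, 0 ≤ g x := fun x => by positivity
  -- the reindexing map `d ↦ ⟨f(d), D₀(d)⟩` is injective on `W` and lands in `F.sigma E`
  have hinj : Set.InjOn (fun d => (⟨ff d, D₀f d⟩ : Σ _ : ℕ, ℤ)) W := by
    intro d hd d' hd' h
    simp only [Sigma.mk.injEq] at h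
    obtain ⟨h1, h2⟩ := h
    rw [hdeq d hd, hdeq d' hd', h1, eq_of_heq h2]
  have hmaps : ∀ d ∈ W, (⟨ff d, D₀f d⟩ : Σ _ : ℕ, ℤ) ∈ F.sigma E := by
    intro d hd
    obtain ⟨hwin, hqd, -⟩ := Finset.mem_filter.mp hd
    obtain ⟨h0, hX⟩ := (mem_discWindow hs).mp hwin
    have hdeq' := hdeq d hd
    have hff' := hff d hd
    have hD₀' := hD₀f d hd
    -- `q ∣ f`
    have hqf : q ∣ ff d := dvd_of_sq_dvd_fundamental_mul_sq hq hq2 hD₀' (hdeq' ▸ hqd)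
    -- `0 < s D₀` and `s D₀ f² < X`
    have hsd : s * d = s * D₀f d * (ff d : ℤ) ^ 2 := by
      conv_lhs => rw [hdeq']
      ring
    have hsD : 0 < s * D₀f d := by
      rw [hsd] at h0
      exact pos_of_mul_pos_left h0 (by positivity)
    have hf2 : ((ff d : ℤ)) ^ 2 ≤ s * d := by
      rw [hsd]
      have h1 : 1 ≤ s * D₀f d := hsD
      nlinarith
    have hfX : (ff d) ^ 2 ≤ X := by
      have : ((ff d : ℤ)) ^ 2 < X := lt_of_le_of_lt hf2 hX
      exact_mod_cast this.le
    have hfle : ff d ≤ X := le_trans (Nat.le_self_pow two_ne_zero _) hfX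
    refine Finset.mem_sigma.mpr ⟨Finset.mem_filter.mpr ⟨Finset.mem_Icc.mpr ⟨hff', hfle⟩, hqf, hfX⟩, ?_⟩
    -- `D₀ ∈ E f`
    rcases hD₀' with hfund | h1
    · refine Finset.mem_insert_of_mem ?_
      -- `s D₀ < Y f`
      have hsDY : s * D₀f d < Y (ff d) := by
        have hmul : s * D₀f d * ((ff d : ℤ)) ^ 2 ≤ (X : ℤ) - 1 := by
          rw [← hsd]; omega
        have hf2pos : (0 : ℤ) < ((ff d : ℤ)) ^ 2 := by positivity
        have hdiv : s * D₀f d ≤ ((X : ℤ) - 1) / ((ff d : ℤ)) ^ 2 := Int.le_ediv_of_mul_le hf2pos hmul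
        have hY' : ((Y (ff d) : ℕ) : ℤ) = ((X - 1 : ℕ) : ℤ) / ((ff d : ℤ)) ^ 2 + 1 := by
          simp only [hYdef]; push_cast; rfl
        have hX1 : ((X - 1 : ℕ) : ℤ) = (X : ℤ) - 1 := by
          have : 1 ≤ X := by
            by_contra hX0
            have : X = 0 := by omega
            rw [this] at hX; push_cast at hX; linarith
          push_cast [this]; ring
        rw [hY', hX1]
        omega
      rcases hs with rfl | rfl
      · rw [if_pos rfl, mem_posFundDiscrs]
        exact ⟨⟨by linarith, by linarith⟩, hfund⟩
      · rw [if_neg (by norm_num), mem_negFundDiscrs]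
        exact ⟨⟨by linarith, by linarith⟩, hfund⟩
    · rw [h1]
      exact Finset.mem_insert_self _ _
  -- Step 3: `Σ_{d ∈ W} N₃(d) ≤ Σ_{⟨f, D₀⟩ ∈ F.sigma E} g`
  have hstep3 : ∑ d ∈ W, (cubicFieldCountOfDisc d : ℝ) ≤ ∑ x ∈ F.sigma E, g x := by
    calc ∑ d ∈ W, (cubicFieldCountOfDisc d : ℝ)
        ≤ ∑ d ∈ W, g ⟨ff d, D₀f d⟩ := Finset.sum_le_sum fun d hd => by
            have h := hBM (D₀f d) (hD₀f d hd) (ff d) (hff d hd)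
            rw [← hdeq d hd] at h
            exact h
      _ = ∑ x ∈ W.image (fun d => (⟨ff d, D₀f d⟩ : Σ _ : ℕ, ℤ)), g x := (Finset.sum_image hinj).symm
      _ ≤ ∑ x ∈ F.sigma E, g x := Finset.sum_le_sum_of_subset_of_nonneg
            (Finset.image_subset_iff.mpr hmaps) fun x _ _ => hg0 x
  -- Step 4: the inner sums: `Σ_{D₀ ∈ E f} t(D₀) ≤ C · Y f + 1 ≤ (2C + 1) X/f²` for `f ∈ F`
  have ht1 : (quadFieldThreeTorsion 1 : ℝ) = 1 := by
    rw [quadFieldThreeTorsion_of_not_isFundamental]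
    · simp
    · rintro (⟨-, -, h⟩ | ⟨h4, -⟩)
      · exact h rfl
      · omega
  have hinner : ∀ f ∈ F, ∑ D₀ ∈ E f, (quadFieldThreeTorsion D₀ : ℝ) ≤ (2 * C + 1) * X / (f : ℝ) ^ 2 := by
    intro f hf
    obtain ⟨hfI, -, hfX⟩ := Finset.mem_filter.mp hf
    have hf1 : 1 ≤ f := (Finset.mem_Icc.mp hfI).1
    have hf0 : (0 : ℝ) < (f : ℝ) ^ 2 := by positivity
    -- `Σ over insert 1 ≤ t(1) + Σ over the fundamental discriminants ≤ 1 + C · Y f`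
    have hle1 : ∑ D₀ ∈ E f, (quadFieldThreeTorsion D₀ : ℝ) ≤
        1 + ∑ D₀ ∈ (if s = 1 then posFundDiscrs (Y f) else negFundDiscrs (Y f)), (quadFieldThreeTorsion D₀ : ℝ) := by
      simp only [hEdef]
      by_cases hmem : (1 : ℤ) ∈ (if s = 1 then posFundDiscrs (Y f) else negFundDiscrs (Y f))
      · rw [Finset.insert_eq_of_mem hmem]
        linarith
      · rw [Finset.sum_insert hmem, ht1]
    have hle2 : ∑ D₀ ∈ (if s = 1 then posFundDiscrs (Y f) else negFundDiscrs (Y f)), (quadFieldThreeTorsion D₀ : ℝ)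
        ≤ C * (Y f) := by
      split_ifs
      · exact (hAC (Y f)).2
      · exact (hAC (Y f)).1
    -- `Y f ≤ X/f² + 1` and `1 ≤ X/f²`
    have hYle : ((Y f : ℕ) : ℝ) ≤ X / (f : ℝ) ^ 2 + 1 := by
      have h1 : (((X - 1) / f ^ 2 : ℕ) : ℝ) ≤ ((X - 1 : ℕ) : ℝ) / ((f ^ 2 : ℕ) : ℝ) := Nat.cast_div_le
      have h2 : ((X - 1 : ℕ) : ℝ) ≤ X := by exact_mod_cast Nat.sub_le X 1
      have h3 : ((X - 1 : ℕ) : ℝ) / ((f ^ 2 : ℕ) : ℝ) ≤ X / (f : ℝ) ^ 2 := by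
        push_cast
        exact div_le_div_of_nonneg_right h2 hf0.le
      simp only [hYdef]
      push_cast
      linarith
    have hXf : (1 : ℝ) ≤ X / (f : ℝ) ^ 2 := by
      rw [le_div_iff₀ hf0, one_mul]
      exact_mod_cast hfX
    calc ∑ D₀ ∈ E f, (quadFieldThreeTorsion D₀ : ℝ) ≤ 1 + C * (Y f) := by linarith
      _ ≤ 1 + C * (X / (f : ℝ) ^ 2 + 1) := by nlinarith
      _ ≤ (2 * C + 1) * (X / (f : ℝ) ^ 2) := by nlinarith
      _ = (2 * C + 1) * X / (f : ℝ) ^ 2 := by ring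
  -- Step 5: `Σ_{x ∈ F.sigma E} g ≤ M (2C+1) X Σ_{f ∈ F} 3^{ω f}/f²`
  have hstep5 : ∑ x ∈ F.sigma E, g x ≤ M * (2 * C + 1) * X * ∑ f ∈ F, ((3 ^ f.primeFactors.card : ℕ) : ℝ) / (f : ℝ) ^ 2 := by
    rw [Finset.sum_sigma, Finset.mul_sum]
    refine Finset.sum_le_sum fun f hf => ?_
    simp only [hgdef]
    rw [← Finset.mul_sum]
    have h3 : (0 : ℝ) ≤ M * 3 ^ f.primeFactors.card := by positivity
    calc M * 3 ^ f.primeFactors.card * ∑ D₀ ∈ E f, (quadFieldThreeTorsion D₀ : ℝ)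
        ≤ M * 3 ^ f.primeFactors.card * ((2 * C + 1) * X / (f : ℝ) ^ 2) :=
          mul_le_mul_of_nonneg_left (hinner f hf) h3
      _ = M * (2 * C + 1) * X * (((3 ^ f.primeFactors.card : ℕ) : ℝ) / (f : ℝ) ^ 2) := by push_cast; ring
  -- Step 6: `Σ_{f ∈ F} 3^{ω f}/f² ≤ 3^{ω q}/q² · e¹⁹` via `f = q g`
  have hstep6 : ∑ f ∈ F, ((3 ^ f.primeFactors.card : ℕ) : ℝ) / (f : ℝ) ^ 2 ≤
      3 ^ q.primeFactors.card / (q : ℝ) ^ 2 * Real.exp 19 := by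
    have hFsub : F ⊆ (Icc 1 X).image (fun g => q * g) := by
      intro f hf
      obtain ⟨hfI, ⟨g, rfl⟩, -⟩ := Finset.mem_filter.mp hf
      obtain ⟨h1, hX⟩ := Finset.mem_Icc.mp hfI
      refine Finset.mem_image.mpr ⟨g, Finset.mem_Icc.mpr ⟨?_, ?_⟩, rfl⟩
      · rcases Nat.eq_zero_or_pos g with rfl | hg
        · omega
        · exact hg
      · exact le_trans (Nat.le_mul_of_pos_left g hq0) hX
    have hinjq : Set.InjOn (fun g => q * g) ((Icc 1 X : Finset ℕ) : Set ℕ) :=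
      fun a _ b _ h => Nat.eq_of_mul_eq_mul_left hq0 h
    calc ∑ f ∈ F, ((3 ^ f.primeFactors.card : ℕ) : ℝ) / (f : ℝ) ^ 2
        ≤ ∑ f ∈ (Icc 1 X).image (fun g => q * g), ((3 ^ f.primeFactors.card : ℕ) : ℝ) / (f : ℝ) ^ 2 :=
          Finset.sum_le_sum_of_subset_of_nonneg hFsub fun f _ _ => by positivity
      _ = ∑ g ∈ Icc 1 X, ((3 ^ (q * g).primeFactors.card : ℕ) : ℝ) / ((q * g : ℕ) : ℝ) ^ 2 := Finset.sum_image hinjq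
      _ ≤ ∑ g ∈ Icc 1 X, 3 ^ q.primeFactors.card / (q : ℝ) ^ 2 * (((3 ^ g.primeFactors.card : ℕ) : ℝ) / (g : ℝ) ^ 2) := by
          refine Finset.sum_le_sum fun g hg => ?_
          have hg1 : 1 ≤ g := (Finset.mem_Icc.mp hg).1
          have hg0 : (0 : ℝ) < g := by exact_mod_cast hg1
          have hq0' : (0 : ℝ) < q := by exact_mod_cast hq0
          have hω : (q * g).primeFactors.card ≤ q.primeFactors.card + g.primeFactors.card := by
            rw [Nat.primeFactors_mul hq0.ne' (by omega)]
            exact Finset.card_union_le _ _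
          have h3 : ((3 ^ (q * g).primeFactors.card : ℕ) : ℝ) ≤
              (3 : ℝ) ^ q.primeFactors.card * ((3 ^ g.primeFactors.card : ℕ) : ℝ) := by
            push_cast
            rw [← pow_add]
            exact_mod_cast Nat.pow_le_pow_right (by norm_num) hω
          rw [div_mul_div_comm, Nat.cast_mul, mul_pow]
          exact div_le_div_of_nonneg_right h3 (by positivity)
      _ = 3 ^ q.primeFactors.card / (q : ℝ) ^ 2 * ∑ g ∈ Icc 1 X, ((3 ^ g.primeFactors.card : ℕ) : ℝ) / (g : ℝ) ^ 2 := by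
          rw [Finset.mul_sum]
      _ ≤ 3 ^ q.primeFactors.card / (q : ℝ) ^ 2 * Real.exp 19 :=
          mul_le_mul_of_nonneg_left (sum_three_pow_card_primeFactors_div_sq_le X) (by positivity)
  -- assembly
  have hX0 : (0 : ℝ) ≤ X := Nat.cast_nonneg X
  calc (S.ncard : ℝ) ≤ ∑ d ∈ W, (cubicFieldCountOfDisc d : ℝ) := hstep1
    _ ≤ ∑ x ∈ F.sigma E, g x := hstep3
    _ ≤ M * (2 * C + 1) * X * ∑ f ∈ F, ((3 ^ f.primeFactors.card : ℕ) : ℝ) / (f : ℝ) ^ 2 := hstep5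
    _ ≤ M * (2 * C + 1) * X * (3 ^ q.primeFactors.card / (q : ℝ) ^ 2 * Real.exp 19) :=
        mul_le_mul_of_nonneg_left hstep6 (by positivity)
    _ = M * (2 * C + 1) * Real.exp 19 * 3 ^ q.primeFactors.card * X / (q : ℝ) ^ 2 := by ring

/-- **Bhargava–Taniguchi–Thorne 2023, Prop. 4.5, from (A) the mean of `#Cl₃` and (B) the class-field-theoretic
count per discriminant** (through `fieldsBound_of_mean_of_perDisc` and the tree's
`btt_uniformity_sqDvd_of_fieldsBound`). [cite: BelabasBhargavaPomerance2010, Lemmas 3.3–3.4] -/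
theorem btt_uniformity_sqDvd_of_mean_of_perDisc
    (hA : ∃ C : ℝ, ∀ Y : ℕ, (∑ D ∈ negFundDiscrs Y, (quadFieldThreeTorsion D : ℝ)) ≤ C * Y ∧
      (∑ D ∈ posFundDiscrs Y, (quadFieldThreeTorsion D : ℝ)) ≤ C * Y)
    (hB : ∃ M : ℝ, ∀ D₀ : ℤ, (((D₀ % 4 = 1 ∧ Squarefree D₀ ∧ D₀ ≠ 1) ∨
      (4 ∣ D₀ ∧ (D₀ / 4 % 4 = 2 ∨ D₀ / 4 % 4 = 3) ∧ Squarefree (D₀ / 4))) ∨ D₀ = 1) → ∀ f : ℕ, 0 < f →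
      (cubicFieldCountOfDisc (D₀ * (f : ℤ) ^ 2) : ℝ) ≤ M * 3 ^ f.primeFactors.card * quadFieldThreeTorsion D₀) :
    btt_uniformity_sqDvd :=
  btt_uniformity_sqDvd_of_fieldsBound (fieldsBound_of_mean_of_perDisc hA hB)

/-! ### (A) from the dictionary and Davenport's bound -/

/-- **The mean of `#Cl₃` from Hasse's dictionary and Davenport's `O(X)` bound** (BBP Lemma 3.3, proof:
"`Σ_{0<±D<X} #Cl₃(D) = O(X)`, which follows from Lemmas 2.2 and 3.1"): if
`#Cl₃(D) = 2·#{cubic fields of disc D} + 1` for fundamental `D` (the statement of the tree's named fact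
`threeTorsion_eq_two_mul_cubicFieldCountOfDisc_add_one`, verbatim) and the `GL₂(ℤ)`-orbits of irreducible
integral binary cubic forms with `0 < s·Disc < X` number `≤ C·X` (Davenport 1951), then
`Σ_{D ∈ negFundDiscrs Y} #Cl₃(D) ≤ (2C+1)·Y` and likewise for `posFundDiscrs`. [cite: BelabasBhargavaPomerance2010, Lemma 3.3 (proof, first display)] -/
theorem mean_threeTorsion_of_dictionary_of_orbitCount
    (hdict : ∀ D : ℤ, ((D % 4 = 1 ∧ Squarefree D ∧ D ≠ 1) ∨
      (4 ∣ D ∧ (D / 4 % 4 = 2 ∨ D / 4 % 4 = 3) ∧ Squarefree (D / 4))) →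
      quadFieldThreeTorsion D = 2 * cubicFieldCountOfDisc D + 1)
    (hcount : ∃ C : ℝ, ∀ s : ℤ, (s = 1 ∨ s = -1) → ∀ X : ℕ,
      (({O | ∃ f : BinaryCubic ℤ, O = gl2zOrbit f ∧ f.IsIrreducible ∧ 0 < s * f.disc ∧ s * f.disc < X}.ncard : ℕ) : ℝ)
        ≤ C * X) :
    ∃ C : ℝ, ∀ Y : ℕ, (∑ D ∈ negFundDiscrs Y, (quadFieldThreeTorsion D : ℝ)) ≤ C * Y ∧
      (∑ D ∈ posFundDiscrs Y, (quadFieldThreeTorsion D : ℝ)) ≤ C * Y := by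
  classical
  obtain ⟨C₀, hC₀⟩ := hcount
  set C : ℝ := max C₀ 0 with hCdef
  have hC0 : 0 ≤ C := le_max_right _ _
  have hC : ∀ s : ℤ, (s = 1 ∨ s = -1) → ∀ X : ℕ,
      (({O | ∃ f : BinaryCubic ℤ, O = gl2zOrbit f ∧ f.IsIrreducible ∧ 0 < s * f.disc ∧ s * f.disc < X}.ncard : ℕ) : ℝ)
        ≤ C * X := fun s hs X =>
    (hC₀ s hs X).trans (mul_le_mul_of_nonneg_right (le_max_left _ _) (Nat.cast_nonneg X))
  set Sd : ℤ → Set (Set (BinaryCubic ℤ)) := fun d =>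
    {O | ∃ f : BinaryCubic ℤ, O = gl2zOrbit f ∧ f.IsIrreducible ∧ IsMaximal f ∧ f.disc = d} with hSd
  -- the sum of `#Cl₃(D) = 2N₃(D) + 1` over fundamental discriminants `D` in the window `0 < s·D < Y`
  have key : ∀ (s : ℤ), (s = 1 ∨ s = -1) → ∀ (Y : ℕ) (T : Finset ℤ),
      (∀ D ∈ T, (0 < s * D ∧ s * D < Y) ∧ ((D % 4 = 1 ∧ Squarefree D ∧ D ≠ 1) ∨
        (4 ∣ D ∧ (D / 4 % 4 = 2 ∨ D / 4 % 4 = 3) ∧ Squarefree (D / 4)))) → T.card ≤ Y →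
      (∑ D ∈ T, (quadFieldThreeTorsion D : ℝ)) ≤ (2 * C + 1) * Y := by
    intro s hs Y T hT hTY
    set B : Set (Set (BinaryCubic ℤ)) :=
      {O | ∃ f : BinaryCubic ℤ, O = gl2zOrbit f ∧ f.IsIrreducible ∧ 0 < s * f.disc ∧ s * f.disc < Y} with hBdef
    have hwin0 : ∀ D : ℤ, 0 < s * D → D ≠ 0 := fun D h0 hD => by
      rw [hD, mul_zero] at h0; exact lt_irrefl 0 h0
    have hBfin : B.Finite := by
      refine (Set.Finite.biUnion (discWindow s Y).finite_toSet fun D hD =>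
        orbitsOfDisc_finite (hwin0 D ((mem_discWindow hs).mp hD).1)).subset ?_
      rintro O ⟨f, rfl, -, h0, hY⟩
      exact Set.mem_biUnion (Finset.mem_coe.mpr ((mem_discWindow hs).mpr ⟨h0, hY⟩)) ⟨f, rfl, rfl⟩
    have hT0 : ∀ D ∈ T, D ≠ 0 := fun D hD => hwin0 D (hT D hD).1.1
    have hsum : ∑ D ∈ T, (cubicFieldCountOfDisc D : ℝ) ≤ C * Y := by
      have h1 : ∑ D ∈ T, cubicFieldCountOfDisc D = (⋃ D ∈ T, Sd D).ncard := by
        rw [ncard_biUnion_eq_sum_of_disjoint T Sd (fun D hD => irredMaximalOrbitsOfDisc_finite (hT0 D hD)) ?_]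
        · exact Finset.sum_congr rfl fun D _ => (ncard_irredMaximalOrbitsOfDisc D).symm
        · intro i _ j _ hij
          refine (disjoint_orbitsOfDisc hij).mono ?_ ?_
          · rintro O ⟨f, hO, -, -, hd⟩
            exact ⟨f, hO, hd⟩
          · rintro O ⟨f, hO, -, -, hd⟩
            exact ⟨f, hO, hd⟩
      have h2 : (⋃ D ∈ T, Sd D) ⊆ B := by
        intro O hO
        obtain ⟨D, hD, hOD⟩ := Set.mem_iUnion₂.mp hO
        obtain ⟨f, rfl, hirr, -, hd⟩ := hOD
        exact ⟨f, rfl, hirr, by rw [hd]; exact (hT D hD).1.1, by rw [hd]; exact (hT D hD).1.2⟩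
      calc ∑ D ∈ T, (cubicFieldCountOfDisc D : ℝ) = ((∑ D ∈ T, cubicFieldCountOfDisc D : ℕ) : ℝ) := by push_cast; rfl
        _ = (((⋃ D ∈ T, Sd D).ncard : ℕ) : ℝ) := by rw [h1]
        _ ≤ (B.ncard : ℝ) := by exact_mod_cast Set.ncard_le_ncard h2 hBfin
        _ ≤ C * Y := hC s hs Y
    calc ∑ D ∈ T, (quadFieldThreeTorsion D : ℝ) = ∑ D ∈ T, (2 * (cubicFieldCountOfDisc D : ℝ) + 1) :=
          Finset.sum_congr rfl fun D hD => by rw [hdict D (hT D hD).2]; push_cast; ring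
      _ = 2 * ∑ D ∈ T, (cubicFieldCountOfDisc D : ℝ) + T.card := by
          rw [Finset.sum_add_distrib, ← Finset.mul_sum, Finset.sum_const, nsmul_eq_mul, mul_one]
      _ ≤ 2 * (C * Y) + Y := by
          have : (T.card : ℝ) ≤ Y := by exact_mod_cast hTY
          linarith
      _ = (2 * C + 1) * Y := by ring
  refine ⟨2 * C + 1, fun Y => ⟨?_, ?_⟩⟩
  · have hT : ∀ D ∈ negFundDiscrs Y, (0 < (-1 : ℤ) * D ∧ (-1 : ℤ) * D < Y) ∧ ((D % 4 = 1 ∧ Squarefree D ∧ D ≠ 1) ∨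
        (4 ∣ D ∧ (D / 4 % 4 = 2 ∨ D / 4 % 4 = 3) ∧ Squarefree (D / 4))) := by
      intro D hD
      obtain ⟨⟨h1, h2⟩, hf⟩ := mem_negFundDiscrs.mp hD
      exact ⟨⟨by omega, by omega⟩, hf⟩
    have hcard : (negFundDiscrs Y).card ≤ Y :=
      calc (negFundDiscrs Y).card ≤ (Finset.Ioo (-(Y : ℤ)) 0).card := Finset.card_le_card (Finset.filter_subset _ _)
        _ ≤ Y := by rw [Int.card_Ioo]; omega
    exact key (-1) (Or.inr rfl) Y (negFundDiscrs Y) hT hcard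
  · have hT : ∀ D ∈ posFundDiscrs Y, (0 < (1 : ℤ) * D ∧ (1 : ℤ) * D < Y) ∧ ((D % 4 = 1 ∧ Squarefree D ∧ D ≠ 1) ∨
        (4 ∣ D ∧ (D / 4 % 4 = 2 ∨ D / 4 % 4 = 3) ∧ Squarefree (D / 4))) := by
      intro D hD
      obtain ⟨⟨h1, h2⟩, hf⟩ := mem_posFundDiscrs.mp hD
      exact ⟨⟨by omega, by omega⟩, hf⟩
    have hcard : (posFundDiscrs Y).card ≤ Y :=
      calc (posFundDiscrs Y).card ≤ (Finset.Ioo (0 : ℤ) Y).card := Finset.card_le_card (Finset.filter_subset _ _)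
        _ ≤ Y := by rw [Int.card_Ioo]; omega
    exact key 1 (Or.inl rfl) Y (posFundDiscrs Y) hT hcard

end Literature.NumberTheory.CubicFields

end
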